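import Summits.ResolutionOfSingularities.ResolutionOfSingularities.Theorems.EquisingularLiftEquisingularLiftNatDepthResidual
import Literature.AlgebraicGeometry.Resolution.CanonicalResolutionProofs
import HarnessLib

/-!
# [OURS] ISOLATED SINGULAR POINTS ARE CLOSED POINTS — the depth theorems with the stub's hypotheses #2 / #7 VERBATIM and nothing about closedness
# (cruxes `Theses.EquisingularLift.EquisingularLiftNat` / `…NatThree`, stmt-ResolutionOfSingularities-20038 / -20148)

[OURS · leafhand-res-equisingularlift-10 g1, 2026-08-31; cell `pub/decomp-res`] AI-produced, weaker than expert review; NOT a statement of any manuscript;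
nothing here proves resolution of singularities in positive characteristic.  DEF-FREE helper; no `sorry`; standard axioms; ZERO named hypotheses.

All `IsoHypPoint` wrappers so far (✓ p829346, p831031, p831199, p831259, p831323, p831361) ask that the listed singular points have CLOSED images in `ℙⁿ`.
For a scheme locally of finite type over a field whose non-regular locus is FINITE this is automatic:

* ★★ `isClosed_singleton_of_finite_nonRegularLocus` — `H → Spec k` locally of finite type, `{x | 𝒪_{H,x} not regular}` finite ⟹ each of its points is
  CLOSED: the regular locus is open (tree ✓ `isOpen_regularLocus_of_locallyOfFiniteType_field`, fields are J-2, Matsumura 30.5), so the non-regular locus `S`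
  is closed; `H` is a Jacobson space (Mathlib `LocallyOfFiniteType.jacobsonSpace`), so `S = closure (S ∩ closed points) = S ∩ closed points` (a finite set of
  closed points is closed);
* ★★★ `isoHypPoint_of_finite_nonRegularLocus_of_levels` — **`k = k̄`, `H` integral, `ι : H ↪ ℙⁿ_k` a closed immersion, `{x | 𝒪_{H,x} not regular}` FINITE
  (hypothesis #2 of the registered isolated residual stub verbatim) and every non-regular point a `D`-point of some level (`D` with UNFOLDING + LOCALITY)
  ⟹ `IsoHypPoint k n H ι`** — no finite set, no closedness, no auxiliary point;
* ★★★ `isoHypPoint_of_finite_nonRegularLocus_tower` — the same for a blow-up tower `D` (`hD0`, `hDsucc`);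
* ★★★ `exists_nonRegular_of_infinite_depth` — **hypotheses #2 (finite non-regular locus) and #7 (`¬ IsoHypPoint`) of the stub ALONE ⟹ some non-regular
  point of `H` has infinite intrinsic blow-up depth (`∀ d, ¬ D d H x`) for every blow-up tower `D`.**

Honest label: closes no registered stub; it is the sharpest description of the isolated residual this programme yields (repair-census datum).

References: [Matsumura1987, Thm. 30.5 / §32]; [StacksProject, Tags 080E, 02OS, 07R1]; [Hartshorne1977, II Ex. 7.12, V 3.9] — through the cited tree files.
-/

set_option linter.dupNamespace false -- mandated namespace `Summit.<Summit>.<Problem>` of this single-conjunct summit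

noncomputable section

open CategoryTheory CategoryTheory.Limits AlgebraicGeometry TopologicalSpace
open Literature.AlgebraicGeometry.Resolution Literature.AlgebraicGeometry.Motives
open AlgebraicGeometry.Scheme.IdealSheafData

namespace Summit.ResolutionOfSingularities.ResolutionOfSingularities.Cruxes.EquisingularLiftNat.Sections

/-- ★★ **ISOLATED SINGULAR POINTS ARE CLOSED POINTS.**  `H → Spec k` locally of finite type with FINITE non-regular locus: every non-regular point of `H` is a
closed point (open regular locus — fields are J-2 — plus the Jacobson property of `H`). [folklore] [cite: Matsumura1987, Thm. 30.5] [cite: StacksProject, Tag 07R1] -/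
theorem isClosed_singleton_of_finite_nonRegularLocus {k : Type} [Field k] {H : Scheme.{0}} (f : H ⟶ Spec (.of k)) [LocallyOfFiniteType f]
    (hfin : Set.Finite {x : H | ¬ IsRegularLocalRing (H.presheaf.stalk x)}) (x : H) (hx : ¬ IsRegularLocalRing (H.presheaf.stalk x)) :
    IsClosed (({x} : Set H)) := by
  haveI : JacobsonSpace H := LocallyOfFiniteType.jacobsonSpace f
  set S : Set H := {x : H | ¬ IsRegularLocalRing (H.presheaf.stalk x)} with hSdef
  have hS : IsClosed S := by
    have hopen := isOpen_regularLocus_of_locallyOfFiniteType_field f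
    have hSc : S = (Scheme.regularLocus H)ᶜ := by
      ext y
      simp only [hSdef, Set.mem_setOf_eq, Set.mem_compl_iff, Scheme.regularLocus]
    rw [hSc]
    exact hopen.isClosed_compl
  have hT : IsClosed (S ∩ closedPoints H) := by
    have hfin' : (S ∩ closedPoints H).Finite := hfin.subset Set.inter_subset_left
    rw [← Set.biUnion_of_singleton (S ∩ closedPoints H)]
    exact hfin'.isClosed_biUnion fun y hy => hy.2
  have key : closure (S ∩ closedPoints H) = S := JacobsonSpace.closure_inter_closedPoints hS
  rw [hT.closure_eq] at key
  have hxS : x ∈ S := hx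
  rw [← key] at hxS
  exact hxS.2

/-- ★★★ **FINITE NON-REGULAR LOCUS, EVERY NON-REGULAR POINT OF SOME `D`-LEVEL ⟹ `IsoHypPoint`** — `k = k̄`, `H` integral, `ι : H ↪ ℙⁿ_k` a closed immersion,
`D` a depth-graded point-property with UNFOLDING and LOCALITY; no finite set, no closedness, no auxiliary point in the hypotheses
(✓ `isoHypPoint_of_finiteDepthPoints` + `isClosed_singleton_of_finite_nonRegularLocus`). [OURS] [cite: StacksProject, Tag 080E] [cite: Matsumura1987, Thm. 30.5] -/
theorem isoHypPoint_of_finite_nonRegularLocus_of_levels (k : Type) [Field k] [IsAlgClosed k] (n : ℕ) (H : Scheme.{0})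
    (ι : H ⟶ (projectiveSpace n k).left) [IsClosedImmersion ι] [IsIntegral H]
    (D : ℕ → ∀ Γ : Scheme.{0}, Γ → Prop)
    (hDstep : ∀ (d : ℕ) (Γ : Scheme.{0}) (y : Γ), D d Γ y → ∀ (hy : IsClosed (({y} : Set Γ))) (Z : Scheme.{0}) (τ : Z ⟶ Γ), IsBlowup τ (vanishingIdeal ⟨{y}, hy⟩) →
        ∃ S' : Finset Z, (∀ z : Z, τ z = y → z ∉ S' → IsRegularLocalRing (Z.presheaf.stalk z)) ∧
          ∀ z ∈ S', τ z = y ∧ IsClosed (({z} : Set Z)) ∧ ∃ d' < d, D d' Z z)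
    (hDloc : ∀ (d : ℕ) (Γ Γ₂ : Scheme.{0}) (ρ : Γ₂ ⟶ Γ) (U : Γ.Opens), IsIso (ρ ∣_ U) → ∀ y : Γ, y ∈ U → IsClosed (({y} : Set Γ)) →
      ∀ y₂ : Γ₂, ρ y₂ = y → IsClosed (({y₂} : Set Γ₂)) → (D d Γ y ↔ D d Γ₂ y₂))
    (hfin : Set.Finite {x : H | ¬ IsRegularLocalRing (H.presheaf.stalk x)})
    (hdepth : ∀ x : H, ¬ IsRegularLocalRing (H.presheaf.stalk x) → ∃ d, D d H x) :
    IsoHypPoint k n H ι := by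
  classical
  have hcl : ∀ x : H, ¬ IsRegularLocalRing (H.presheaf.stalk x) → IsClosed (({ι x} : Set (projectiveSpace n k).left)) := by
    intro x hx
    have h := ι.isClosedEmbedding.isClosedMap _ (isClosed_singleton_of_finite_nonRegularLocus (ι ≫ (projectiveSpace n k).hom) hfin x hx)
    rwa [Set.image_singleton] at h
  refine isoHypPoint_of_finiteDepthPoints k n H ι D hDstep hDloc hfin.toFinset (fun x hx => hcl x (hfin.mem_toFinset.mp hx))
    (fun x hx => hfin.mem_toFinset.mp hx) (fun x hx => ?_) (fun x hx => hdepth x (hfin.mem_toFinset.mp hx))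
  by_contra h
  exact hx (hfin.mem_toFinset.mpr h)

/-- ★★★ **FINITE NON-REGULAR LOCUS, EVERY NON-REGULAR POINT OF FINITE INTRINSIC BLOW-UP DEPTH ⟹ `IsoHypPoint`** — the same for a blow-up tower `D`
(`hD0`, `hDsucc`; ✓ `tower_step`, ✓ `tower_loc`). [OURS] [cite: StacksProject, Tag 080E] [cite: Matsumura1987, Thm. 30.5] -/
theorem isoHypPoint_of_finite_nonRegularLocus_tower (k : Type) [Field k] [IsAlgClosed k] (n : ℕ) (H : Scheme.{0})
    (ι : H ⟶ (projectiveSpace n k).left) [IsClosedImmersion ι] [IsIntegral H]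
    (D : ℕ → ∀ Γ : Scheme.{0}, Γ → Prop)
    (hD0 : ∀ (Γ : Scheme.{0}) (y : Γ), IsClosed (({y} : Set Γ)) →
      (D 0 Γ y ↔ ∀ (hy : IsClosed (({y} : Set Γ))) (Z : Scheme.{0}) (τ : Z ⟶ Γ), IsBlowup τ (vanishingIdeal ⟨{y}, hy⟩) →
        ∀ z : Z, τ z = y → IsRegularLocalRing (Z.presheaf.stalk z)))
    (hDsucc : ∀ (d : ℕ) (Γ : Scheme.{0}) (y : Γ), IsClosed (({y} : Set Γ)) →
      (D (d + 1) Γ y ↔ ∀ (hy : IsClosed (({y} : Set Γ))) (Z : Scheme.{0}) (τ : Z ⟶ Γ), IsBlowup τ (vanishingIdeal ⟨{y}, hy⟩) →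
        ∃ S' : Finset Z, (∀ z : Z, τ z = y → z ∉ S' → IsRegularLocalRing (Z.presheaf.stalk z)) ∧
          ∀ z ∈ S', τ z = y ∧ IsClosed (({z} : Set Z)) ∧ ∃ d' ≤ d, D d' Z z))
    (hfin : Set.Finite {x : H | ¬ IsRegularLocalRing (H.presheaf.stalk x)})
    (hdepth : ∀ x : H, ¬ IsRegularLocalRing (H.presheaf.stalk x) → ∃ d, D d H x) :
    IsoHypPoint k n H ι :=
  isoHypPoint_of_finite_nonRegularLocus_of_levels k n H ι D (tower_step D hD0 hDsucc) (tower_loc D hD0 hDsucc) hfin hdepth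

/-- ★★★ **HYPOTHESES #2 AND #7 OF THE ISOLATED RESIDUAL STUB ALONE ⟹ A NON-REGULAR POINT OF INFINITE INTRINSIC BLOW-UP DEPTH.**  `k = k̄`, `H` integral,
`ι : H ↪ ℙⁿ_k` a closed immersion with `Set.Finite {x | ¬ IsRegularLocalRing 𝒪_{H,x}}` and `¬ IsoHypPoint k n H ι`; `D` any blow-up tower.  Then some
non-regular point `x` of `H` has `∀ d, ¬ D d H x`: over it, every finite sequence of rounds of closed-point blow-ups leaves a singular point. [OURS]
[cite: StacksProject, Tag 080E] [cite: Matsumura1987, Thm. 30.5] -/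
theorem exists_nonRegular_of_infinite_depth (k : Type) [Field k] [IsAlgClosed k] (n : ℕ) (H : Scheme.{0})
    (ι : H ⟶ (projectiveSpace n k).left) [IsClosedImmersion ι] [IsIntegral H]
    (D : ℕ → ∀ Γ : Scheme.{0}, Γ → Prop)
    (hD0 : ∀ (Γ : Scheme.{0}) (y : Γ), IsClosed (({y} : Set Γ)) →
      (D 0 Γ y ↔ ∀ (hy : IsClosed (({y} : Set Γ))) (Z : Scheme.{0}) (τ : Z ⟶ Γ), IsBlowup τ (vanishingIdeal ⟨{y}, hy⟩) →
        ∀ z : Z, τ z = y → IsRegularLocalRing (Z.presheaf.stalk z)))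
    (hDsucc : ∀ (d : ℕ) (Γ : Scheme.{0}) (y : Γ), IsClosed (({y} : Set Γ)) →
      (D (d + 1) Γ y ↔ ∀ (hy : IsClosed (({y} : Set Γ))) (Z : Scheme.{0}) (τ : Z ⟶ Γ), IsBlowup τ (vanishingIdeal ⟨{y}, hy⟩) →
        ∃ S' : Finset Z, (∀ z : Z, τ z = y → z ∉ S' → IsRegularLocalRing (Z.presheaf.stalk z)) ∧
          ∀ z ∈ S', τ z = y ∧ IsClosed (({z} : Set Z)) ∧ ∃ d' ≤ d, D d' Z z))
    (hfin : Set.Finite {x : H | ¬ IsRegularLocalRing (H.presheaf.stalk x)})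
    (hnot : ¬ IsoHypPoint k n H ι) :
    ∃ x : H, ¬ IsRegularLocalRing (H.presheaf.stalk x) ∧ ∀ d : ℕ, ¬ D d H x := by
  by_contra hcon
  push Not at hcon
  exact hnot (isoHypPoint_of_finite_nonRegularLocus_tower k n H ι D hD0 hDsucc hfin hcon)

end Summit.ResolutionOfSingularities.ResolutionOfSingularities.Cruxes.EquisingularLiftNat.Sections

end
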